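import Literature.AnabelianGeometry.EtaleTheta.SettingModelChiInversionAut
import Literature.AnabelianGeometry.EtaleTheta.Discharge.Sec1InvNegatesFdd1Quot
import HarnessLib

/-!
# [EtTh] Prop. 1.5 (iii), inversion clauses: `InvClauses` WITNESSED at the χ-model — `ι` fixes `η̈^Θ + log(O^×_K̈)`
# and sends `log(Ü)` to `−log(Ü)` (proof-only)

Mochizuki, *The étale theta function and its Frobenioid-theoretic manifestations*, Publ. RIMS **45** (2009) [EtTh],
Prop. 1.5 (iii) p. 23: «any inversion automorphism ι … fixes η̈^Θ + log(O^×_K̈), but maps log(Ü) + log(O^×_K̈) to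
−log(Ü) + log(O^×_K̈)» [cite: MochizukiEtTh2009, Prop 1.5 (iii) p.23].  abc-iut cell, layer L2, prover abc-iut-L2-d1
(gen 5); PROOF-ONLY instantiation (13:00Z v-next census item C11a, second half; row R295) of abc-iut-L2-t1's predicate
`ThetaSetting.InvClauses E hι cι` (`ThetaCohomologyInversion`) at abc-iut-L2-t1's `ThetaSetting.modelχ p`, for
* `E := etaleThetaDataχSec p (etaDdχ p)` — abc-iut-w5-d029's section Kummer datum of the χ-model with THIS seat's
  non-trivial theta class `etaDdχ` (`SettingModelChiThetaCocycle(Sec)`);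
* `hι := isInversionAut_twistedInversion_modelχ p` (this seat, `SettingModelChiInversionAut`) — the twisted inversion
  `(γ, σ) ↦ (ι_Γ γ, σ)` IS an inversion automorphism;
* EVERY theta companion `cι` of it (abc-iut-L2-t1's `IsInversionAut.thetaIso_apply_eq_self`: `ι^Θ = id` on `Δ_Θ`
  for any companion of an inversion automorphism).

Contents:
* `transportFun_twistedInversion_eq_self_of_aug` — a cocycle on `Π^tp_Ÿ` that factors through `aug` is FIXED by the
  transport `ι^Θ ∘ f ∘ ι⁻¹` (Thm. 1.6 (iii)): `ι` is over `G_K` and `ι^Θ` fixes `Δ_Θ`;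
* `transport_inflTheta_kumYdd_kummerDataχSec` / `transport_eq_self_of_mem_kumUnitsYdd` — hence `ι` fixes every Kummer
  class `log(O^×_K̈)` of the section datum (its cocycles are `h ↦ f(aug^Θ h)`, `kumOfSection_mk`);
* `transport_etaDdχ` — `ι` fixes `η̈^Θ := etaDdχ` for every companion (the model cocycle `g ↦ (0,0,z(g))^Θ` has
  `ι`-invariant levels: `negXY (0,0,z) = (0,0,z)`);
* **`image_thetaClasses_modelχ`** — clause (a): `ι(η̈^Θ + log(O^×_K̈)) = η̈^Θ + log(O^×_K̈)`;
* `eHatB_sigmaHat` (`ê_b ∘ σ̂ = (·)⁻¹`), `yCoordχ_twistedInversion` (`ŷ(ι g) = ŷ(g)⁻¹`),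
  `transport_inflTheta_logUddχ` (`ι_* log(Ü) = −log(Ü)` on `Π^tp_Ÿ`), **`apply_logUddχ_eq_inv`** — clause (b) with
  `u := 1`: every intertwiner `T` of the Θ-level classes has `T(log(Ü)) = −log(Ü)` (abc-iut-L2-t12's `inflTheta_injective`);
* **`invClauses_modelχ`** — `InvClauses (etaleThetaDataχSec p (etaDdχ p)) hι cι` for every companion `cι`, and the
  named instance `invClauses_modelχ_thetaCompanionOfAut`; NV `ThetaSetting.exists_isEtThOrigin_invClauses`.
NOT instantiable here: `Prop15iiiInv` / `FixesCuspBelow` quantify over cuspidal points of `Ÿ`, and `modelχ` has no cusp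
datum (`Pt` empty) — the cusped twin is abc-iut-w5-d029's `modelχ′`.  SEMI-SYNTHETIC MODEL, consistency evidence only;
nothing of [EtTh] asserted; no side taken on [IUTchIII] Cor. 3.12.
-/

noncomputable section

namespace Literature.AnabelianGeometry.EtaleTheta.SettingModel

open Literature.AnabelianGeometry.SemiGraphs _root_.Function

variable (p : ℕ) [Fact p.Prime]
  (cι : ThetaSetting.ThetaCompanion (Dα := ThetaSetting.modelχ p) (Dβ := ThetaSetting.modelχ p)
    (twistedInversionTop (chi p) (isInducing_leftRightχ p)))

/-- `negXY (x, y, z) = (−x, −y, z)`. [cite: MochizukiEtTh2009, Prop 2.2 (i) p.37] -/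
private theorem negXY_apply_aux₃ {R : Type*} [CommRing R] (a : Heis R) : Heis.negXY a = ⟨-a.x, -a.y, a.z⟩ := rfl

/-! ### `ι^Θ` fixes `Δ_Θ`; `ι` is over `G_K` -/

/-- `ι^Θ(a) = a` for `a ∈ Δ_Θ`, for EVERY theta companion of the twisted inversion (abc-iut-L2-t1's
`IsInversionAut.thetaIso_apply_eq_self` at `isInversionAut_twistedInversion_modelχ`). [cite: MochizukiEtTh2009, Prop 1.5 (iii) p.23] -/
theorem thetaIso_twistedInversion_apply_eq_self {a : (ThetaSetting.modelχ p).GtpTheta}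
    (ha : a ∈ (ThetaSetting.modelχ p).DeltaTheta) : cι.thetaIso a = a :=
  (isInversionAut_twistedInversion_modelχ p).thetaIso_apply_eq_self cι ha

/-- `aug (ι⁻¹ x) = aug x`. [cite: Mochizuki2012, Rmk 1.4.1 (ii) p.28] -/
theorem aug_twistedInversionTop_symm (x : PiTpχ p) :
    (ThetaSetting.modelχ p).aug ((twistedInversionTop (chi p) (isInducing_leftRightχ p)).symm x) =
      (ThetaSetting.modelχ p).aug x := by
  rw [twistedInversionTop_symm_apply]
  exact aug_twistedInversion_modelχ p x

/-! ### Cocycles through `aug` are fixed by the transport -/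

/-- **A cocycle on `Π^tp_Ÿ` factoring through `aug` is fixed by `ι^Θ ∘ f ∘ ι⁻¹`** (the transport of Thm. 1.6 (iii)):
`ι⁻¹` does not change `aug`, and `ι^Θ` fixes the values (in `Δ_Θ`). [cite: MochizukiEtTh2009, Thm 1.6 (iii) p.24] -/
theorem transportFun_twistedInversion_eq_self_of_aug
    (f : ↥(ThetaSetting.modelχ p).GtpYdd → ↥(ThetaSetting.modelχ p).DeltaTheta)
    (hf : ∀ x y : ↥(ThetaSetting.modelχ p).GtpYdd,
      (ThetaSetting.modelχ p).aug (x : PiTpχ p) = (ThetaSetting.modelχ p).aug (y : PiTpχ p) → f x = f y) :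
    ThetaSetting.transportFun cι (isInversionAut_twistedInversion_modelχ p).thm16i f = f := by
  funext x
  apply Subtype.ext
  change cι.thetaIso (f ⟨(twistedInversionTop (chi p) (isInducing_leftRightχ p)).symm (x : PiTpχ p), _⟩).1 = (f x).1
  rw [thetaIso_twistedInversion_apply_eq_self p cι (f _).2]
  exact congrArg Subtype.val (hf _ _ (aug_twistedInversionTop_symm p x))

/-- **`ι` fixes every Kummer class of the section datum**: `ι_* infl(κ(k)) = infl(κ(k))` for all
`k ∈ H¹(G_K̈, Δ_Θ)` (the inflated Kummer cocycle is `g ↦ f(aug g)`). [cite: MochizukiEtTh2009, Prop 1.5 (iii) p.23] -/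
theorem transport_inflTheta_kumYdd_kummerDataχSec (k : (kummerDataχSec p).KddHat) :
    ThetaSetting.transport cι (isInversionAut_twistedInversion_modelχ p).thm16i
        ((ThetaSetting.modelχ p).inflTheta (ThetaSetting.modelχ p).GtpYdd ((kummerDataχSec p).kumYdd k)) =
      (ThetaSetting.modelχ p).inflTheta (ThetaSetting.modelχ p).GtpYdd ((kummerDataχSec p).kumYdd k) := by
  induction k using QuotientGroup.induction_on with
  | H f =>
    change ContH1.mk _ _ = ContH1.mk _ _
    refine ContH1.mk_congr _ (transportFun_twistedInversion_eq_self_of_aug p cι _ fun x y hxy => ?_) _ _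
    change f.1 ⟨(kummerCoreχ p).augTheta ((ThetaSetting.modelχ p).toTheta (x : PiTpχ p)), _⟩ =
      f.1 ⟨(kummerCoreχ p).augTheta ((ThetaSetting.modelχ p).toTheta (y : PiTpχ p)), _⟩
    exact congrArg f.1 (Subtype.ext (by
      change (kummerCoreχ p).augTheta _ = (kummerCoreχ p).augTheta _
      rw [(kummerCoreχ p).augTheta_toTheta, (kummerCoreχ p).augTheta_toTheta]
      exact hxy))

/-- **`ι` fixes `log(O^×_K̈)`**: every element of `kumUnitsYdd` of the section datum is fixed by the transport.
[cite: MochizukiEtTh2009, Prop 1.5 (iii) p.23] -/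
theorem transport_eq_self_of_mem_kumUnitsYdd {k : (ThetaSetting.modelχ p).H1 (ThetaSetting.modelχ p).GtpYdd}
    (hk : k ∈ (kummerDataχSec p).kumUnitsYdd) :
    ThetaSetting.transport cι (isInversionAut_twistedInversion_modelχ p).thm16i k = k := by
  obtain ⟨c, -, rfl⟩ := hk
  exact transport_inflTheta_kumYdd_kummerDataχSec p cι c

/-! ### `ι` fixes `η̈^Θ` (every companion) -/

/-- The model's theta cocycle at `ι⁻¹ x` and at `x` agree: the levels of `centreRep (ι_Γ γ)` and `centreRep γ` are both
`(0, 0, z(γ))` (`negXY` fixes `z`). [cite: MochizukiEtTh2009, Thm 1.6 (iii) p.24] -/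
theorem thetaCocycleFunχ_twistedInversionTop_symm (x : ↥(ThetaSetting.modelχ p).GtpYdd) :
    thetaCocycleFunχ p ⟨(twistedInversionTop (chi p) (isInducing_leftRightχ p)).symm (x : PiTpχ p),
        (ThetaSetting.modelχ p).GtpYdd_le_GtpY
          (ThetaSetting.symm_mem_GtpYdd (isInversionAut_twistedInversion_modelχ p).thm16i x)⟩ =
      thetaCocycleFunχ p ⟨x, (ThetaSetting.modelχ p).GtpYdd_le_GtpY x.2⟩ := by
  have hx : (x : PiTpχ p).left ∈ gfpSnd.ker :=
    left_mem_ker_of_mem_GtpY ((ThetaSetting.modelχ p).GtpYdd_le_GtpY x.2)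
  have hx' : gfpInv (x : PiTpχ p).left ∈ gfpSnd.ker := by
    rw [MonoidHom.mem_ker, gfpSnd_gfpInv, inv_eq_one]; exact hx
  apply Subtype.ext
  change CurveTheta.toTheta (curveχ p) (SemidirectProduct.inl (centreRep
      ((twistedInversionTop (chi p) (isInducing_leftRightχ p)).symm (x : PiTpχ p)).left)) =
    CurveTheta.toTheta (curveχ p) (SemidirectProduct.inl (centreRep (x : PiTpχ p).left))
  rw [twistedInversionTop_symm_apply, twistedInversion_left]
  refine toTheta_eq_of_right_eq_one p _ _ (SemidirectProduct.right_inl _) (SemidirectProduct.right_inl _) ?_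
  rw [mem_closure_commutator₃_iff_forall_hHat]
  intro N
  rw [SemidirectProduct.left_inl, SemidirectProduct.left_inl, map_mul, map_inv]
  change levelHom N (centreRep (gfpInv (x : PiTpχ p).left)) * (levelHom N (centreRep (x : PiTpχ p).left))⁻¹ = 1
  rw [levelHom_centreRep N hx', levelHom_centreRep N hx, levelHom_gfpInv, negXY_apply_aux₃, mul_inv_eq_one]

/-- **The transport of the model's theta cocycle along `(ι, ι^Θ)` IS the cocycle**, for every companion `ι^Θ`.
[cite: MochizukiEtTh2009, Thm 1.6 (iii) p.24] -/
theorem transportFun_thetaCocycleχ :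
    ThetaSetting.transportFun cι (isInversionAut_twistedInversion_modelχ p).thm16i
        (fun g : ↥(ThetaSetting.modelχ p).GtpYdd =>
          thetaCocycleFunχ p ⟨g, (ThetaSetting.modelχ p).GtpYdd_le_GtpY g.2⟩) =
      fun g : ↥(ThetaSetting.modelχ p).GtpYdd => thetaCocycleFunχ p ⟨g, (ThetaSetting.modelχ p).GtpYdd_le_GtpY g.2⟩ := by
  funext x
  apply Subtype.ext
  change cι.thetaIso (thetaCocycleFunχ p ⟨(twistedInversionTop (chi p) (isInducing_leftRightχ p)).symm (x : PiTpχ p),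
      (ThetaSetting.modelχ p).GtpYdd_le_GtpY
        (ThetaSetting.symm_mem_GtpYdd (isInversionAut_twistedInversion_modelχ p).thm16i x)⟩).1 =
    (thetaCocycleFunχ p ⟨x, (ThetaSetting.modelχ p).GtpYdd_le_GtpY x.2⟩).1
  rw [thetaIso_twistedInversion_apply_eq_self p cι (thetaCocycleFunχ p _).2,
    thetaCocycleFunχ_twistedInversionTop_symm]

/-- **`ι_* η̈^Θ = η̈^Θ`** for the model class `etaDdχ`, for EVERY theta companion of the twisted inversion
(for the quotient-map companion this is `transport_etaDdχ_twistedInversion`). [cite: MochizukiEtTh2009, Prop 1.5 (iii) p.23] -/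
theorem transport_etaDdχ :
    ThetaSetting.transport cι (isInversionAut_twistedInversion_modelχ p).thm16i (etaDdχ p) = etaDdχ p := by
  rw [etaDdχ_eq_mk]
  change ContH1.mk (ThetaSetting.transportFun _ _ _) _ = ContH1.mk _ _
  congr 1
  exact transportFun_thetaCocycleχ p cι

/-! ### Clause (a): `ι` fixes `η̈^Θ + log(O^×_K̈)` -/

/-- **Prop. 1.5 (iii) clause (a) at the χ-model**: the transport along `ι` maps the set of étale theta classes
`O^×_K̈ · η̈^Θ` of `etaleThetaDataχSec p (etaDdχ p)` onto itself (indeed fixes it pointwise).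
[cite: MochizukiEtTh2009, Prop 1.5 (iii) p.23] -/
theorem image_thetaClasses_modelχ :
    ThetaSetting.transport cι (isInversionAut_twistedInversion_modelχ p).thm16i ''
        (etaleThetaDataχSec p (etaDdχ p)).thetaClasses =
      (etaleThetaDataχSec p (etaDdχ p)).thetaClasses := by
  have hfix : ∀ x ∈ (etaleThetaDataχSec p (etaDdχ p)).thetaClasses,
      ThetaSetting.transport cι (isInversionAut_twistedInversion_modelχ p).thm16i x = x := by
    rintro x ⟨k, hk, rfl⟩
    rw [map_mul, transport_eq_self_of_mem_kumUnitsYdd p cι hk]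
    exact congrArg (k * ·) (transport_etaDdχ p cι)
  ext x
  constructor
  · rintro ⟨y, hy, rfl⟩
    rw [hfix y hy]
    exact hy
  · intro hx
    exact ⟨x, hx, hfix x hx⟩

/-! ### Clause (b): `ι` sends `log(Ü)` to `−log(Ü)` -/

/-- **`ê_b(σ̂ x) = ê_b(x)⁻¹`**: the inversion `σ̂` of `F̂₂` negates the `b`-exponent (levels: `ĥ_N ∘ σ̂ = negXY ∘ ĥ_N`).
[cite: MochizukiEtTh2009, Prop 2.2 (i) p.37] -/
theorem eHatB_sigmaHat (x : F₂hatT) : eHatB (sigmaHat x) = (eHatB x)⁻¹ := by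
  refine ext_of_modN fun N => ?_
  rw [map_inv, ← hHat_y_eq_modN_eHatB, ← hHat_y_eq_modN_eHatB, hHat_sigmaHat, ← ofAdd_neg]
  rfl

/-- **`ŷ(ι g) = ŷ(g)⁻¹`**: the twisted inversion negates the `y`-coordinate crossed homomorphism.
[cite: MochizukiEtTh2009, Prop 1.5 (iii) p.23] -/
theorem yCoordχ_twistedInversion (g : PiTpχ p) :
    yCoordχ p (twistedInversion (chi p) g) = (yCoordχ p g)⁻¹ := by
  unfold yCoordχ
  rw [twistedInversion_left]
  exact eHatB_sigmaHat (gfpFst g.left)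

/-- `ŷ(ι⁻¹ x)^Θ = (ŷ(x)^Θ)⁻¹` on `(Π^tp_X)^Θ`. [cite: MochizukiEtTh2009, Prop 1.5 (iii) p.23] -/
theorem yThetaχ_toTheta_twistedInversionTop_symm (x : PiTpχ p) :
    yThetaχ p ((ThetaSetting.modelχ p).toTheta ((twistedInversionTop (chi p) (isInducing_leftRightχ p)).symm x)) =
      (yThetaχ p ((ThetaSetting.modelχ p).toTheta x))⁻¹ := by
  rw [twistedInversionTop_symm_apply]
  exact yCoordχ_twistedInversion p x

/-- **The `log(Ü)`-cocycle at `ι⁻¹ x` is the inverse of its value at `x`** (`c^{ŷ/2}` with `ŷ ↦ ŷ⁻¹`).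
[cite: MochizukiEtTh2009, Prop 1.5 (iii) p.23] -/
theorem logUddFunχ_twistedInversionTop_symm (x : ↥(ThetaSetting.modelχ p).GtpYdd) :
    logUddFunχ p ⟨(ThetaSetting.modelχ p).toTheta
          ((twistedInversionTop (chi p) (isInducing_leftRightχ p)).toMulEquiv.symm (x : PiTpχ p)),
        ⟨_, ThetaSetting.symm_mem_GtpYdd (isInversionAut_twistedInversion_modelχ p).thm16i x, rfl⟩⟩ =
      (logUddFunχ p ⟨(ThetaSetting.modelχ p).toTheta (x : PiTpχ p), ⟨x.1, x.2, rfl⟩⟩)⁻¹ := by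
  unfold logUddFunχ
  rw [← map_inv, ← map_inv]
  refine congrArg (fun t : ↥sqHom.range => deltaThetaCoordχ p (half t)) (Subtype.ext ?_)
  exact yThetaχ_toTheta_twistedInversionTop_symm p x

/-- **`ι_* log(Ü) = −log(Ü)` on `Π^tp_Ÿ`**: the transport of the inflated `log(Ü)`-class is its inverse, for every
companion. [cite: MochizukiEtTh2009, Prop 1.5 (iii) p.23] -/
theorem transport_inflTheta_logUddχ :
    ThetaSetting.transport cι (isInversionAut_twistedInversion_modelχ p).thm16i
        ((ThetaSetting.modelχ p).inflTheta (ThetaSetting.modelχ p).GtpYdd (logUddχ p)) =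
      ((ThetaSetting.modelχ p).inflTheta (ThetaSetting.modelχ p).GtpYdd (logUddχ p))⁻¹ := by
  rw [eq_inv_iff_mul_eq_one]
  change ContH1.mk _ _ * ContH1.mk _ _ = 1
  rw [ContH1.mk_mul_mk, ← ContH1.mk_one]
  refine ContH1.mk_congr _ (funext fun x => ?_) _ _
  rw [Pi.mul_apply, Pi.one_apply, mul_eq_one_iff_eq_inv]
  apply Subtype.ext
  change cι.thetaIso (logUddFunχ p ⟨(ThetaSetting.modelχ p).toTheta
      ((twistedInversionTop (chi p) (isInducing_leftRightχ p)).toMulEquiv.symm (x : PiTpχ p)), _⟩).1 =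
    ((logUddFunχ p ⟨(ThetaSetting.modelχ p).toTheta (x : PiTpχ p), _⟩)⁻¹).1
  rw [thetaIso_twistedInversion_apply_eq_self p cι (logUddFunχ p _).2]
  exact congrArg Subtype.val (logUddFunχ_twistedInversionTop_symm p x)

/-- **Prop. 1.5 (iii) clause (b) at the χ-model, with `u := 1`**: every automorphism `T` of `H¹((Π^tp_Ÿ)^Θ, Δ_Θ)`
intertwining the transport along `ι` (through the injective inflation, abc-iut-L2-t12's `inflTheta_injective`) sends
`log(Ü)` to `−log(Ü)`. [cite: MochizukiEtTh2009, Prop 1.5 (iii) p.23] -/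
theorem apply_logUddχ_eq_inv
    (T : (ThetaSetting.modelχ p).H1Theta ((ThetaSetting.modelχ p).GtpYdd.map (ThetaSetting.modelχ p).toTheta) ≃*
      (ThetaSetting.modelχ p).H1Theta ((ThetaSetting.modelχ p).GtpYdd.map (ThetaSetting.modelχ p).toTheta))
    (hT : ∀ z, (ThetaSetting.modelχ p).inflTheta (ThetaSetting.modelχ p).GtpYdd (T z) =
      ThetaSetting.transport cι (isInversionAut_twistedInversion_modelχ p).thm16i
        ((ThetaSetting.modelχ p).inflTheta (ThetaSetting.modelχ p).GtpYdd z)) :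
    T (logUddχ p) = (logUddχ p)⁻¹ := by
  apply (ThetaSetting.modelχ p).inflTheta_injective (ThetaSetting.modelχ p).GtpYdd
  rw [hT, map_inv, transport_inflTheta_logUddχ p cι]

/-! ### `InvClauses` at the χ-model -/

/-- **[EtTh] Prop. 1.5 (iii), inversion clauses, WITNESSED at the χ-model**: for the section datum with the model's
theta class `etaDdχ`, the twisted inversion (an inversion automorphism, `isInversionAut_twistedInversion_modelχ`) and
EVERY theta companion of it, `InvClauses` holds — `ι` fixes `η̈^Θ + log(O^×_K̈)` and sends `log(Ü)` to `−log(Ü)`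
(`u := 1`).  (`Prop15iiiInv` itself quantifies over cuspidal points of `Ÿ`, of which `modelχ` has none.)
[cite: MochizukiEtTh2009, Prop 1.5 (iii) p.23] -/
theorem invClauses_modelχ :
    ThetaSetting.InvClauses (etaleThetaDataχSec p (etaDdχ p)) (isInversionAut_twistedInversion_modelχ p) cι where
  image_thetaClasses := image_thetaClasses_modelχ p cι
  logUdd_inv T hT := ⟨1, Subgroup.one_mem _, by
    rw [map_one, map_one, mul_one]
    exact apply_logUddχ_eq_inv p cι T hT⟩

/-- The same for the named companion `ι^Θ := thetaCompanionOfAut ι` (the quotient-map companion used in this seat's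
`hιη_modelχ`). [cite: MochizukiEtTh2009, Prop 1.5 (iii) p.23] -/
theorem invClauses_modelχ_thetaCompanionOfAut :
    ThetaSetting.InvClauses (etaleThetaDataχSec p (etaDdχ p)) (isInversionAut_twistedInversion_modelχ p)
      ((ThetaSetting.modelχ p).thetaCompanionOfAut (twistedInversionTop (chi p) (isInducing_leftRightχ p))
        (map_deltaTemp_twistedInversion_modelχ p) (isQuotientMap_toTheta_modelχ p)) :=
  invClauses_modelχ p _

/-- **Census form (NV for C11a)**: there are a Theta setting of [EtTh] origin, an inversion automorphism `ι` of it with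
a theta companion, and étale theta data `E` with NON-TRIVIAL `η̈^Θ` for which `InvClauses E hι cι` holds.
[cite: MochizukiEtTh2009, Prop 1.5 (iii) p.23] -/
theorem _root_.Literature.AnabelianGeometry.EtaleTheta.ThetaSetting.exists_isEtThOrigin_invClauses :
    ∃ (D : ThetaSetting p) (ι : D.PiTemp ≃ₜ* D.PiTemp) (hι : D.IsInversionAut ι) (cι : ThetaSetting.ThetaCompanion ι)
      (E : D.EtaleThetaData), D.IsEtThOrigin ∧ E.etaDd ≠ 1 ∧ ThetaSetting.InvClauses E hι cι :=
  ⟨ThetaSetting.modelχ p, twistedInversionTop (chi p) (isInducing_leftRightχ p), isInversionAut_twistedInversion_modelχ p,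
    (ThetaSetting.modelχ p).thetaCompanionOfAut (twistedInversionTop (chi p) (isInducing_leftRightχ p))
      (map_deltaTemp_twistedInversion_modelχ p) (isQuotientMap_toTheta_modelχ p),
    etaleThetaDataχSec p (etaDdχ p), ThetaSetting.modelχ_isEtThOrigin p, etaDd_etaleThetaDataχSec_etaDdχ_ne_one p,
    invClauses_modelχ_thetaCompanionOfAut p⟩

end Literature.AnabelianGeometry.EtaleTheta.SettingModel

end
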